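import Mathlib.RingTheory.RootsOfUnity.PrimitiveRoots
import Literature.NumberTheory.GaloisRepresentations.BrauerTower
import Literature.NumberTheory.GaloisRepresentations.ContinuousCorestriction
import Literature.NumberTheory.GaloisRepresentations.AbsGaloisGroupProofs
import Literature.NumberTheory.GaloisRepresentations.CyclotomicLevels
import Literature.NumberTheory.GaloisRepresentations.DecompositionGroupOfCompletion
import HarnessLib

/-!
# Localisation of level cohomology at the places of the level field above a fixed place

Topic `NumberTheory/GaloisRepresentations`; namespace `Literature.NumberTheory.GaloisRepresentations`.
Generic plumbing for Euler–Kolyvagin-system arguments (Rubin, *Euler Systems* (2000), Ch. III §2.1,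
Ch. IV §4: the classes over the LEVEL field `K(μ_m)` are localised at its places above `p`; Kato,
Astérisque 295 (2004), §9.4 / Thm. 9.7: the dual exponential of the level `ℚ(ζ_m)` is the sum over
`w ∣ p` of local maps on `H¹(ℚ(μ_m)_w, V)`).  In the tree the cohomology of the LEVEL `K(μ_m)` is the
continuous cohomology `Hⁿ(U, X)` of the open subgroup `U = Gal(K̄/K(μ_m)) = rootsOfUnityFixer K m ≤ Γ_K`
(`CyclotomicLevels`, `EulerSystem.H1 T U`), and LOCAL cohomology at a field `E ⊇ K` is the cohomology
of `Γ_E` acting through the chosen restriction `absGaloisRestrict K E` (`GaloisRep.restrictField`;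
its image is the decomposition group of `adicCompletionPrime K v` when `E = K_v`,
`DecompositionGroupOfCompletion`).  This file supplies the maps between the two, for a field `F`
containing the relevant roots of unity — a completion `K(μ_m)_w` in ANY model
(`w.adicCompletion (CyclotomicField m K)`, a finite extension of `K_v`, an abstract local field):

* §1 `mem_rootsOfUnityFixer_of_compatible`: for ANY pair `(ι' : K̄ → F̄, r' : Γ_F → Γ_K)` with
  `ι' (r' σ • x) = σ • ι' x`, **if `F ∋` a primitive `n`-th root of unity then `r'` lands in
  `Gal(K̄/K(μ_n))`**; instances `absGaloisRestrict_mem_rootsOfUnityFixer` (direct restriction) and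
  `absGaloisRestrictTower_mem_rootsOfUnityFixer` (the composite `res_{E/K} ∘ res_{F/E}` of a tower).
* §2 DIRECT localisation `locField K F X n : Hⁿ(Γ_K, X) ⟶ Hⁿ(Γ_F, X)` and, for `U ⊇ res (Γ_F)`,
  **`locLevel K F X U hU n : Hⁿ(U, X) ⟶ Hⁿ(Γ_F, X)`** (Mathlib `ContinuousCohomology.map` along the
  corestriction `absGaloisRestrictInto`), cocycle formulas, `locLevel_resSubgroup : loc^U ∘ res_U = loc`.
* §3 TOWER localisation for `K ⊆ E ⊆ F` (intended `E = K_v`, `F/E` finite with `F ∋ ζ_m`):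
  `absGaloisRestrictTower K E F = res_{E/K} ∘ res_{F/E}`, `resTower` (`= res_{F/E}` on `Hⁿ(Γ_E, X|_E)`),
  **`locTower K E F X U hU n : Hⁿ(U, X) ⟶ Hⁿ(Γ_F, (X|_E)|_F)`** with target `X` carrying the TOWER
  action (the currency of a representation restricted to `Γ_{K_v}` and then to a finite extension, as
  in the `p`-adic Hodge theory files), the HONEST identity **`locTower_resSubgroup :
  loc_tower^U (res_U x) = res_{F/E} (loc_E x)`** (all degrees; both sides are `map` along the same
  composite — no conjugation), the cocycle formula and `locTower_resLe` (change of level).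
* §4 (`K` a number field, `E = K_v`): the tower restriction lands in `U ⊓ D_{𝔓₀}`,
  `𝔓₀ = adicCompletionPrime K v ∈ v.primesAbove`, `D_{𝔓₀} = MulAction.stabilizer Γ_K 𝔓₀` — the
  currency of "local at `p`" clauses quantified over `𝔓 ∈ v.primesAbove` (`Kato2004.ZetaBody` (C3b)) —
  and `locTower_eq_zero_of_resLe_inf_eq_zero`.

Why two localisations: `res_{E/K} ∘ res_{F/E}` and `res_{F/K}` agree only up to an inner automorphism
of `Γ_K` (`absGaloisRestrict_isConj_of_algHom_holds`; on `H¹` the two are intertwined by that element,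
`ConjugationDescent.map_eq_map_of_inner_one`); the TOWER version is the one for which restriction
from `E` to `F` is an honest equality of maps.  Everything PROVED (functoriality along explicit
compatible pairs); the definitions are thin wrappers with `rfl` unfolding lemmas.  NOT here:
corestriction, the comparison of the two localisations, inertia
(`LocalGaloisGroupInertiaProofs.absInertia_map_absGaloisRestrict_le_holds` composes with §4).

## References
* J.-P. Serre, *Galois Cohomology* (1997), I §2.4 (compatible pairs), II §1.1. [SerreGaloisCohomology1997]
* K. Rubin, *Euler Systems*, Annals of Math. Studies 147 (2000), Ch. III §2.1, Ch. IV §4. [Rubin2000]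
* J. Neukirch, *Algebraic Number Theory* (1999), Ch. II §9 Prop. (9.6). [NeukirchANT1999]
* J. S. Milne, *Fields and Galois Theory*, Ch. 7 (restriction well defined up to conjugacy). [MilneFT2022]
-/

noncomputable section

open CategoryTheory Field
open scoped Pointwise

universe u v w
namespace Literature.NumberTheory.GaloisRepresentations

open _root_.TopRep _root_.ContinuousCohomology

/-! ## §1. A field containing `μ_n` restricts into `Gal(K̄/K(μ_n))` -/

section RootsOfUnity

variable (K : Type u) (F : Type w) [Field K] [Field F] [Algebra K F]

/-- **Compatible pairs land in `Gal(K̄/K(μ_n))` when `F ∋ ζ_n`**: for a `K`-embedding `ι' : K̄ → F̄`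
and `r' : Γ_F → Γ_K` with `ι' (r' σ • x) = σ • ι' x`, if `F` contains a primitive `n`-th root of unity
(`n ≠ 0`) then `r' σ` fixes every `n`-th root of unity `t` of `K̄` (`ι' t` is a power of `ζ ∈ F`).
Ref: Rubin, *Euler Systems* (2000), Ch. III §2.1; Neukirch (1999), Ch. IV §1. [cite: NeukirchANT1999, Ch. IV §1 (infinite Galois theory: `Gal(K̄/K(μ_n))`, restriction)] -/
theorem mem_rootsOfUnityFixer_of_compatible {n : ℕ} [NeZero n] {ζ : F} (hζ : IsPrimitiveRoot ζ n)
    (ι' : AlgebraicClosure K →ₐ[K] AlgebraicClosure F)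
    (r' : absoluteGaloisGroup F → absoluteGaloisGroup K)
    (hr' : ∀ (σ : absoluteGaloisGroup F) (x : AlgebraicClosure K), ι' (r' σ • x) = σ • ι' x)
    (σ : absoluteGaloisGroup F) : r' σ ∈ rootsOfUnityFixer K n := by
  rw [mem_rootsOfUnityFixer_iff]
  intro t ht
  have hζ' : IsPrimitiveRoot (algebraMap F (AlgebraicClosure F) ζ) n :=
    hζ.map_of_injective (algebraMap F (AlgebraicClosure F)).injective
  have hjt : (ι' t) ^ n = 1 := by rw [← map_pow, ht, map_one]
  obtain ⟨i, -, hi⟩ := hζ'.eq_pow_of_pow_eq_one hjt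
  apply ι'.toRingHom.injective
  change ι' (r' σ • t) = ι' t
  rw [hr', ← hi, smul_pow', Field.absoluteGaloisGroup.smul_def, AlgEquiv.commutes]

/-- **If `F ⊇ K` contains a primitive `n`-th root of unity (`n ≠ 0`), the restriction
`res : Γ_F → Γ_K` lands in `Gal(K̄/K(μ_n)) = rootsOfUnityFixer K n`.** [cite: NeukirchANT1999, Ch. IV §1] -/
theorem absGaloisRestrict_mem_rootsOfUnityFixer {n : ℕ} [NeZero n] {ζ : F} (hζ : IsPrimitiveRoot ζ n)
    (σ : absoluteGaloisGroup F) : absGaloisRestrict K F σ ∈ rootsOfUnityFixer K n :=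
  mem_rootsOfUnityFixer_of_compatible K F hζ (absClosureEmbedding K F) _
    (absGaloisRestrict_apply_smul K F) σ

/-- The same for every divisor `d ∣ n` of the order of the root of unity in `F`. [cite: NeukirchANT1999, Ch. IV §1] -/
theorem absGaloisRestrict_mem_rootsOfUnityFixer_of_dvd {n d : ℕ} [NeZero n] {ζ : F}
    (hζ : IsPrimitiveRoot ζ n) (hd : d ∣ n) (σ : absoluteGaloisGroup F) :
    absGaloisRestrict K F σ ∈ rootsOfUnityFixer K d := by
  obtain ⟨e, rfl⟩ := hd
  have he : e ≠ 0 := fun h => NeZero.ne (d * e) (by rw [h, mul_zero])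
  haveI : NeZero d := ⟨fun h => NeZero.ne (d * e) (by rw [h, zero_mul])⟩
  exact absGaloisRestrict_mem_rootsOfUnityFixer K F (hζ.pow_of_dvd he (Dvd.intro_left d rfl) |>
    fun h => by rwa [Nat.mul_div_cancel _ (Nat.pos_of_ne_zero he)] at h) σ

end RootsOfUnity

/-! ## §2. The direct localisation of level cohomology at `F` -/

section Direct

variable {R : Type v} [CommRing R] [TopologicalSpace R]
variable (K F : Type u) [Field K] [Field F] [Algebra K F]

/-- The restriction `res : Γ_F → Γ_K` corestricted to a subgroup `U ≤ Γ_K` containing its image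
(intended: `U = Gal(K̄/K(μ_m))`, `F ⊇ K(μ_m)`), as a continuous homomorphism `Γ_F →ₜ* U`. [folklore] -/
def absGaloisRestrictInto (U : Subgroup (absoluteGaloisGroup K))
    (hU : ∀ σ, absGaloisRestrict K F σ ∈ U) : absoluteGaloisGroup F →ₜ* U where
  toMonoidHom := (absGaloisRestrict K F).toMonoidHom.codRestrict U hU
  continuous_toFun := (absGaloisRestrict K F).continuous.subtype_mk _

/-- Unfolding `absGaloisRestrictInto`: its value at `σ` is `res σ`. [cite: SerreGaloisCohomology1997, I §2.4 (compatible pairs)] -/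
@[simp] theorem coe_absGaloisRestrictInto_apply (U : Subgroup (absoluteGaloisGroup K))
    (hU : ∀ σ, absGaloisRestrict K F σ ∈ U) (σ : absoluteGaloisGroup F) :
    (absGaloisRestrictInto K F U hU σ : absoluteGaloisGroup K) = absGaloisRestrict K F σ := rfl

variable (X : TopRep.{u} R (absoluteGaloisGroup K))

/-- `X` as a topological `Γ_F`-module through the direct restriction `res : Γ_F → Γ_K` (Mathlib
`TopRep.res`; for `X = T.toTopRep` this is the module underlying `GaloisRep.restrictField F T`).
[folklore] -/
abbrev fieldRep : TopRep.{u} R (absoluteGaloisGroup F) :=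
  TopRep.res (absGaloisRestrict K F : absoluteGaloisGroup F →* absoluteGaloisGroup K) X

/-- **The localisation `loc_F : Hⁿ(Γ_K, X) ⟶ Hⁿ(Γ_F, X)`** at a field `F ⊇ K`: Mathlib's
`ContinuousCohomology.map` along the pair `(res, id_X)` (= `ContinuousRep.cohomologyRes` along
`absGaloisRestrict K F`; `galoisCohomology.res` for discrete modules). Serre (1997), II §1.1. [folklore] -/
def locField (n : ℕ) : continuousCohomology n X ⟶ continuousCohomology n (fieldRep K F X) :=
  ContinuousCohomology.map (absGaloisRestrict K F) (X := X) (Y := fieldRep K F X)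
    (TopRep.ofHom ⟨ContinuousLinearMap.id R X, fun _ => rfl⟩) n

/-- **The direct localisation of LEVEL cohomology `loc_F^U : Hⁿ(U, X) ⟶ Hⁿ(Γ_F, X)`** (`U ≤ Γ_K`
containing `res (Γ_F)`): `ContinuousCohomology.map` along `(res : Γ_F → U, id_X)`.
Ref: Rubin, *Euler Systems* (2000), Ch. IV §4; Serre (1997), I §2.4. [folklore] -/
def locLevel (U : Subgroup (absoluteGaloisGroup K)) (hU : ∀ σ, absGaloisRestrict K F σ ∈ U) (n : ℕ) :
    continuousCohomology n (subgroupRep X U) ⟶ continuousCohomology n (fieldRep K F X) :=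
  ContinuousCohomology.map (absGaloisRestrictInto K F U hU) (X := subgroupRep X U)
    (Y := fieldRep K F X) (TopRep.ofHom ⟨ContinuousLinearMap.id R X, fun _ => rfl⟩) n

/-- `loc_F` on explicit cocycles: `loc_F [φ] = [φ ∘ res]`. [cite: SerreGaloisCohomology1997, II §1.1 (localisation) with I §2.4] -/
theorem locField_oneCocycleClass (φ : contOneCocycles X) :
    locField K F X 1 (oneCocycleClass X φ) =
      oneCocycleClass _ (contOneCocycles.pullback (absGaloisRestrict K F) (Y := fieldRep K F X)
        (TopRep.ofHom ⟨ContinuousLinearMap.id R X, fun _ => rfl⟩) φ) :=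
  map_oneCocycleClass _ _ _ φ

/-- `loc_F^U` on explicit cocycles: `loc_F^U [φ] = [φ ∘ res]`. [cite: SerreGaloisCohomology1997, I §2.4 (compatible pairs)] -/
theorem locLevel_oneCocycleClass (U : Subgroup (absoluteGaloisGroup K))
    (hU : ∀ σ, absGaloisRestrict K F σ ∈ U) (φ : contOneCocycles (subgroupRep X U)) :
    locLevel K F X U hU 1 (oneCocycleClass _ φ) =
      oneCocycleClass _ (contOneCocycles.pullback (absGaloisRestrictInto K F U hU)
        (Y := fieldRep K F X) (TopRep.ofHom ⟨ContinuousLinearMap.id R X, fun _ => rfl⟩) φ) :=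
  map_oneCocycleClass _ _ _ φ

/-- The value of the localised cocycle: `(φ ∘ res)(σ) = φ(res σ)`. [cite: SerreGaloisCohomology1997, I §2.4 (compatible pairs)] -/
theorem locLevel_pullback_apply (U : Subgroup (absoluteGaloisGroup K))
    (hU : ∀ σ, absGaloisRestrict K F σ ∈ U) (φ : contOneCocycles (subgroupRep X U))
    (σ : absoluteGaloisGroup F) :
    (contOneCocycles.pullback (absGaloisRestrictInto K F U hU) (Y := fieldRep K F X)
        (TopRep.ofHom ⟨ContinuousLinearMap.id R X, fun _ => rfl⟩) φ).1 σ =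
      φ.1 ⟨absGaloisRestrict K F σ, hU σ⟩ := rfl

/-- **Compatibility with global classes**: `loc_F^U (res_U x) = loc_F x` for `x ∈ Hⁿ(Γ_K, X)`
(`res : Γ_F → Γ_K` factors as `Γ_F → U ↪ Γ_K`). Serre (1997), I §2.4. [cite: SerreGaloisCohomology1997, I §2.4 (compatible pairs, functoriality)] -/
theorem locLevel_resSubgroup (U : Subgroup (absoluteGaloisGroup K))
    (hU : ∀ σ, absGaloisRestrict K F σ ∈ U) (n : ℕ) (x : continuousCohomology n X) :
    locLevel K F X U hU n (resSubgroup X U n x) = locField K F X n x := by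
  unfold locLevel resSubgroup locField
  exact (map_comp_apply_of (X := X) (Y := subgroupRep X U) (Z := fieldRep K F X)
    (subgroupSubtypeHom U) (absGaloisRestrictInto K F U hU) (absGaloisRestrict K F)
    (fun _ => rfl) (TopRep.ofHom ⟨ContinuousLinearMap.id R X, fun _ => rfl⟩)
    (TopRep.ofHom ⟨ContinuousLinearMap.id R X, fun _ => rfl⟩)
    (TopRep.ofHom ⟨ContinuousLinearMap.id R X, fun _ => rfl⟩) (fun _ => rfl) n x).symm

/-- Change of level: `loc_F^U (res_{U ≤ U'} y) = loc_F^{U'} y`. [cite: SerreGaloisCohomology1997, I §2.4 (compatible pairs, functoriality)] -/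
theorem locLevel_resLe {U U' : Subgroup (absoluteGaloisGroup K)} (h : U ≤ U')
    (hU : ∀ σ, absGaloisRestrict K F σ ∈ U) (n : ℕ) (y : continuousCohomology n (subgroupRep X U')) :
    locLevel K F X U hU n (resLe X h n y) = locLevel K F X U' (fun σ => h (hU σ)) n y := by
  unfold locLevel resLe
  exact (map_comp_apply_of (X := subgroupRep X U') (Y := subgroupRep X U) (Z := fieldRep K F X)
    (Literature.NumberTheory.EllipticCurves.subgroupInclusion h)
    (absGaloisRestrictInto K F U hU) (absGaloisRestrictInto K F U' fun σ => h (hU σ))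
    (fun _ => rfl) (TopRep.ofHom ⟨ContinuousLinearMap.id R X, fun _ => rfl⟩)
    (TopRep.ofHom ⟨ContinuousLinearMap.id R X, fun _ => rfl⟩)
    (TopRep.ofHom ⟨ContinuousLinearMap.id R X, fun _ => rfl⟩) (fun _ => rfl) n y).symm

end Direct

/-! ## §3. The tower localisation `Hⁿ(U, X) ⟶ Hⁿ(Γ_F, (X|_E)|_F)` for `K ⊆ E ⊆ F` -/

section Tower

variable {R : Type v} [CommRing R] [TopologicalSpace R]
variable (K E F : Type u) [Field K] [Field E] [Field F] [Algebra K E] [Algebra E F]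

/-- The composite restriction `res_{E/K} ∘ res_{F/E} : Γ_F →ₜ* Γ_K` along a tower `K ⊆ E ⊆ F`
(through the chosen embeddings `K̄ → Ē → F̄`; equal to `res_{F/K}` up to an inner automorphism of
`Γ_K`; the map through which a representation restricted to `Γ_E`, then to `Γ_F`, is a `Γ_F`-module).
[folklore] -/
def absGaloisRestrictTower : absoluteGaloisGroup F →ₜ* absoluteGaloisGroup K :=
  (absGaloisRestrict K E).comp (absGaloisRestrict E F)

/-- Unfolding `absGaloisRestrictTower`. [cite: MilneFT2022, Ch. 7 (the absolute Galois group: restriction maps)] -/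
@[simp] theorem absGaloisRestrictTower_apply (σ : absoluteGaloisGroup F) :
    absGaloisRestrictTower K E F σ = absGaloisRestrict K E (absGaloisRestrict E F σ) := rfl

/-- The tower restriction is compatible with the composite embedding `K̄ → Ē → F̄`. [cite: MilneFT2022, Ch. 7 (the absolute Galois group: restriction maps)] -/
theorem absClosureEmbedding_absGaloisRestrictTower_smul (σ : absoluteGaloisGroup F)
    (x : AlgebraicClosure K) :
    absClosureEmbedding E F (absClosureEmbedding K E (absGaloisRestrictTower K E F σ • x)) =
      σ • absClosureEmbedding E F (absClosureEmbedding K E x) := by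
  rw [absGaloisRestrictTower_apply, absGaloisRestrict_apply_smul, absGaloisRestrict_apply_smul]

/-- **If `F` contains a primitive `n`-th root of unity, the tower restriction `res_{E/K} ∘ res_{F/E}`
lands in `Gal(K̄/K(μ_n))`** (§1 for the compatible pair `(ι_{F/E} ∘ ι_{E/K}, res_{E/K} ∘ res_{F/E})`).
[cite: NeukirchANT1999, Ch. IV §1] -/
theorem absGaloisRestrictTower_mem_rootsOfUnityFixer [Algebra K F] [IsScalarTower K E F]
    {n : ℕ} [NeZero n] {ζ : F} (hζ : IsPrimitiveRoot ζ n) (σ : absoluteGaloisGroup F) :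
    absGaloisRestrictTower K E F σ ∈ rootsOfUnityFixer K n :=
  mem_rootsOfUnityFixer_of_compatible K F hζ
    (((absClosureEmbedding E F).restrictScalars K).comp (absClosureEmbedding K E)) _
    (absClosureEmbedding_absGaloisRestrictTower_smul K E F) σ

/-- The same for every divisor `d ∣ n`. [cite: NeukirchANT1999, Ch. IV §1] -/
theorem absGaloisRestrictTower_mem_rootsOfUnityFixer_of_dvd [Algebra K F] [IsScalarTower K E F]
    {n d : ℕ} [NeZero n] {ζ : F} (hζ : IsPrimitiveRoot ζ n) (hd : d ∣ n) (σ : absoluteGaloisGroup F) :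
    absGaloisRestrictTower K E F σ ∈ rootsOfUnityFixer K d := by
  obtain ⟨e, rfl⟩ := hd
  have he : e ≠ 0 := fun h => NeZero.ne (d * e) (by rw [h, mul_zero])
  haveI : NeZero d := ⟨fun h => NeZero.ne (d * e) (by rw [h, zero_mul])⟩
  exact absGaloisRestrictTower_mem_rootsOfUnityFixer K E F (hζ.pow_of_dvd he (Dvd.intro_left d rfl) |>
    fun h => by rwa [Nat.mul_div_cancel _ (Nat.pos_of_ne_zero he)] at h) σ

/-- The image of the tower restriction lies in `range res_{E/K}` (`= D_{𝔓₀}` for `E = K_v`, §4). [cite: NeukirchANT1999, Ch. II §9 Prop. (9.6)] -/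
theorem absGaloisRestrictTower_mem_range (σ : absoluteGaloisGroup F) :
    absGaloisRestrictTower K E F σ ∈ (absGaloisRestrict K E).toMonoidHom.range :=
  ⟨absGaloisRestrict E F σ, rfl⟩

/-- The tower restriction corestricted to a subgroup `U ≤ Γ_K` containing its image, as a continuous
homomorphism `Γ_F →ₜ* U`. [folklore] -/
def absGaloisRestrictTowerInto (U : Subgroup (absoluteGaloisGroup K))
    (hU : ∀ σ, absGaloisRestrictTower K E F σ ∈ U) : absoluteGaloisGroup F →ₜ* U where
  toMonoidHom := (absGaloisRestrictTower K E F).toMonoidHom.codRestrict U hU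
  continuous_toFun := (absGaloisRestrictTower K E F).continuous.subtype_mk _

/-- Unfolding `absGaloisRestrictTowerInto`. [cite: SerreGaloisCohomology1997, I §2.4 (compatible pairs)] -/
@[simp] theorem coe_absGaloisRestrictTowerInto_apply (U : Subgroup (absoluteGaloisGroup K))
    (hU : ∀ σ, absGaloisRestrictTower K E F σ ∈ U) (σ : absoluteGaloisGroup F) :
    (absGaloisRestrictTowerInto K E F U hU σ : absoluteGaloisGroup K) =
      absGaloisRestrict K E (absGaloisRestrict E F σ) := rfl

variable (X : TopRep.{u} R (absoluteGaloisGroup K))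

/-- `X` as a topological `Γ_F`-module through the TOWER `res_{E/K} ∘ res_{F/E}`: the module
`X|_E = fieldRep K E X` restricted once more along `res_{F/E}` (for `X = T.toTopRep`: the module
underlying `(T.restrictField E).restrictField F`). [folklore] -/
abbrev towerRep : TopRep.{u} R (absoluteGaloisGroup F) :=
  TopRep.res (absGaloisRestrict E F : absoluteGaloisGroup F →* absoluteGaloisGroup E) (fieldRep K E X)

/-- **Restriction in the tower `res_{F/E} : Hⁿ(Γ_E, X|_E) ⟶ Hⁿ(Γ_F, (X|_E)|_F)`** (the plain
localisation from `E` to its extension `F`, `locField E F (X|_E)` with target spelled `towerRep`).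
Ref: Serre, *Galois Cohomology* (1997), II §1.1. [folklore] -/
def resTower (n : ℕ) : continuousCohomology n (fieldRep K E X) ⟶ continuousCohomology n (towerRep K E F X) :=
  ContinuousCohomology.map (absGaloisRestrict E F) (X := fieldRep K E X) (Y := towerRep K E F X)
    (TopRep.ofHom ⟨ContinuousLinearMap.id R X, fun _ => rfl⟩) n

/-- **The tower localisation of LEVEL cohomology `loc_tower^U : Hⁿ(U, X) ⟶ Hⁿ(Γ_F, (X|_E)|_F)`** for a
subgroup `U ≤ Γ_K` containing the image of `res_{E/K} ∘ res_{F/E}` (the level `Gal(K̄/K(μ_m))` when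
`F ∋ ζ_m`, `absGaloisRestrictTower_mem_rootsOfUnityFixer`): `ContinuousCohomology.map` along the
compatible pair `(res_{E/K} ∘ res_{F/E} : Γ_F → U, id_X)`.
Ref: Rubin, *Euler Systems* (2000), Ch. IV §4; Serre, *Galois Cohomology* (1997), I §2.4. [folklore] -/
def locTower (U : Subgroup (absoluteGaloisGroup K)) (hU : ∀ σ, absGaloisRestrictTower K E F σ ∈ U)
    (n : ℕ) : continuousCohomology n (subgroupRep X U) ⟶ continuousCohomology n (towerRep K E F X) :=
  ContinuousCohomology.map (absGaloisRestrictTowerInto K E F U hU) (X := subgroupRep X U)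
    (Y := towerRep K E F X) (TopRep.ofHom ⟨ContinuousLinearMap.id R X, fun _ => rfl⟩) n

/-- `loc_tower^U` on explicit cocycles: `[φ] ↦ [φ ∘ (res_{E/K} ∘ res_{F/E})]`. [cite: SerreGaloisCohomology1997, I §2.4 (compatible pairs)] -/
theorem locTower_oneCocycleClass (U : Subgroup (absoluteGaloisGroup K))
    (hU : ∀ σ, absGaloisRestrictTower K E F σ ∈ U) (φ : contOneCocycles (subgroupRep X U)) :
    locTower K E F X U hU 1 (oneCocycleClass _ φ) =
      oneCocycleClass _ (contOneCocycles.pullback (absGaloisRestrictTowerInto K E F U hU)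
        (Y := towerRep K E F X) (TopRep.ofHom ⟨ContinuousLinearMap.id R X, fun _ => rfl⟩) φ) :=
  map_oneCocycleClass _ _ _ φ

/-- The value of the tower-localised cocycle: `σ ↦ φ (res_{E/K} (res_{F/E} σ))`. [cite: SerreGaloisCohomology1997, I §2.4 (compatible pairs)] -/
theorem locTower_pullback_apply (U : Subgroup (absoluteGaloisGroup K))
    (hU : ∀ σ, absGaloisRestrictTower K E F σ ∈ U) (φ : contOneCocycles (subgroupRep X U))
    (σ : absoluteGaloisGroup F) :
    (contOneCocycles.pullback (absGaloisRestrictTowerInto K E F U hU) (Y := towerRep K E F X)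
        (TopRep.ofHom ⟨ContinuousLinearMap.id R X, fun _ => rfl⟩) φ).1 σ =
      φ.1 ⟨absGaloisRestrict K E (absGaloisRestrict E F σ), hU σ⟩ := rfl

/-- `res_{F/E}` on explicit cocycles: `[ψ] ↦ [ψ ∘ res_{F/E}]`. [cite: SerreGaloisCohomology1997, II §1.1 (localisation) with I §2.4] -/
theorem resTower_oneCocycleClass (ψ : contOneCocycles (fieldRep K E X)) :
    resTower K E F X 1 (oneCocycleClass _ ψ) =
      oneCocycleClass _ (contOneCocycles.pullback (absGaloisRestrict E F) (X := fieldRep K E X)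
        (Y := towerRep K E F X) (TopRep.ofHom ⟨ContinuousLinearMap.id R X, fun _ => rfl⟩) ψ) :=
  map_oneCocycleClass _ _ _ ψ

/-- **The honest tower identity `loc_tower^U (res_U x) = res_{F/E} (loc_E x)`** for `x ∈ Hⁿ(Γ_K, X)`:
both sides are `ContinuousCohomology.map` along the composite `Γ_F → Γ_E → Γ_K = Γ_F → U ↪ Γ_K` with
identity module maps (no conjugation, all degrees); so a global class `κ` with `res_U κ = y` has
`res_{F/E} (loc_E κ) = loc_tower^U y` — the shape consumed by semi-local arguments.
Serre (1997), I §2.4. [cite: SerreGaloisCohomology1997, I §2.4 (compatible pairs, functoriality)] -/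
theorem locTower_resSubgroup (U : Subgroup (absoluteGaloisGroup K))
    (hU : ∀ σ, absGaloisRestrictTower K E F σ ∈ U) (n : ℕ) (x : continuousCohomology n X) :
    locTower K E F X U hU n (resSubgroup X U n x) = resTower K E F X n (locField K E X n x) := by
  unfold locTower resSubgroup resTower locField
  have h1 := map_comp_apply_of (X := X) (Y := subgroupRep X U) (Z := towerRep K E F X)
    (subgroupSubtypeHom U) (absGaloisRestrictTowerInto K E F U hU) (absGaloisRestrictTower K E F)
    (fun _ => rfl) (TopRep.ofHom ⟨ContinuousLinearMap.id R X, fun _ => rfl⟩)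
    (TopRep.ofHom ⟨ContinuousLinearMap.id R X, fun _ => rfl⟩)
    (TopRep.ofHom ⟨ContinuousLinearMap.id R X, fun _ => rfl⟩) (fun _ => rfl) n x
  have h2 := map_comp_apply_of (X := X) (Y := fieldRep K E X) (Z := towerRep K E F X)
    (absGaloisRestrict K E) (absGaloisRestrict E F) (absGaloisRestrictTower K E F)
    (fun _ => rfl) (TopRep.ofHom ⟨ContinuousLinearMap.id R X, fun _ => rfl⟩)
    (TopRep.ofHom ⟨ContinuousLinearMap.id R X, fun _ => rfl⟩)
    (TopRep.ofHom ⟨ContinuousLinearMap.id R X, fun _ => rfl⟩) (fun _ => rfl) n x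
  exact h1.symm.trans h2

/-- Change of level for the tower localisation: `loc_tower^U (res_{U ≤ U'} y) = loc_tower^{U'} y`.
[cite: SerreGaloisCohomology1997, I §2.4 (compatible pairs, functoriality)] -/
theorem locTower_resLe {U U' : Subgroup (absoluteGaloisGroup K)} (h : U ≤ U')
    (hU : ∀ σ, absGaloisRestrictTower K E F σ ∈ U) (n : ℕ)
    (y : continuousCohomology n (subgroupRep X U')) :
    locTower K E F X U hU n (resLe X h n y) = locTower K E F X U' (fun σ => h (hU σ)) n y := by
  unfold locTower resLe
  exact (map_comp_apply_of (X := subgroupRep X U') (Y := subgroupRep X U) (Z := towerRep K E F X)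
    (Literature.NumberTheory.EllipticCurves.subgroupInclusion h)
    (absGaloisRestrictTowerInto K E F U hU) (absGaloisRestrictTowerInto K E F U' fun σ => h (hU σ))
    (fun _ => rfl) (TopRep.ofHom ⟨ContinuousLinearMap.id R X, fun _ => rfl⟩)
    (TopRep.ofHom ⟨ContinuousLinearMap.id R X, fun _ => rfl⟩)
    (TopRep.ofHom ⟨ContinuousLinearMap.id R X, fun _ => rfl⟩) (fun _ => rfl) n y).symm

end Tower

/-! ## §4. Number fields: the tower restriction lands in `U ⊓ D_{𝔓₀}`, `𝔓₀ = adicCompletionPrime K v` -/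

section NumberField

open scoped NumberField
open IsDedekindDomain

variable (K : Type) [Field K] [NumberField K] (v : HeightOneSpectrum (𝓞 K))
variable (F : Type) [Field F] [Algebra (v.adicCompletion K) F]

/-- **The tower restriction `Γ_F → Γ_{K_v} → Γ_K` lands in the decomposition group `D_{𝔓₀}` of the
tree's prime `𝔓₀ = adicCompletionPrime K v` above `v`** (`D_{𝔓₀} = res (Γ_{K_v})`,
`decompositionSubgroup_adicCompletionPrime_eq_range`; `D_{𝔓₀} = MulAction.stabilizer Γ_K 𝔓₀` by
definition).  Neukirch, *Algebraic Number Theory* (1999), Ch. II §9 Prop. (9.6).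
[cite: NeukirchANT1999, Ch. II §9 Prop. (9.6)] -/
theorem absGaloisRestrictTower_mem_decompositionSubgroup (σ : absoluteGaloisGroup F) :
    absGaloisRestrictTower K (v.adicCompletion K) F σ ∈
      (adicCompletionPrime K v).decompositionSubgroup (absoluteGaloisGroup K) := by
  rw [decompositionSubgroup_adicCompletionPrime_eq_range]
  exact absGaloisRestrictTower_mem_range K (v.adicCompletion K) F σ

/-- **For a level `U ∋ res(Γ_F)`, the tower restriction lands in `U ⊓ MulAction.stabilizer Γ_K 𝔓₀`**
(and `𝔓₀ ∈ v.primesAbove`, `adicCompletionPrime_mem_primesAbove`): the currency of "local at `p`"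
clauses quantified over `𝔓 ∈ v.primesAbove` (`Kato2004.ZetaBody` (C3b)). [cite: NeukirchANT1999, Ch. II §9 Prop. (9.6)] -/
theorem absGaloisRestrictTower_mem_inf_stabilizer {U : Subgroup (absoluteGaloisGroup K)}
    (hU : ∀ σ, absGaloisRestrictTower K (v.adicCompletion K) F σ ∈ U) (σ : absoluteGaloisGroup F) :
    absGaloisRestrictTower K (v.adicCompletion K) F σ ∈
      U ⊓ MulAction.stabilizer (absoluteGaloisGroup K) (adicCompletionPrime K v) :=
  ⟨hU σ, absGaloisRestrictTower_mem_decompositionSubgroup K v F σ⟩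

/-- **A level class vanishing on `U ⊓ D_{𝔓₀}` has vanishing tower localisation** (all degrees;
`Γ_F → U` factors through `U ⊓ D_{𝔓₀}`): how the "local at `p`" axiom of a value datum (vanishing on
classes that die on every `U ⊓ MulAction.stabilizer Γ_K 𝔓`, `𝔓 ∣ p`) is met by `loc_tower`-data. [cite: SerreGaloisCohomology1997, I §2.4 (compatible pairs, functoriality)] -/
theorem locTower_eq_zero_of_resLe_inf_eq_zero {R : Type v} [CommRing R] [TopologicalSpace R]
    (X : TopRep.{0} R (absoluteGaloisGroup K)) {U : Subgroup (absoluteGaloisGroup K)}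
    (hU : ∀ σ, absGaloisRestrictTower K (v.adicCompletion K) F σ ∈ U) (n : ℕ)
    (y : continuousCohomology n (subgroupRep X U))
    (hy : resLe X (inf_le_left : U ⊓ MulAction.stabilizer (absoluteGaloisGroup K)
      (adicCompletionPrime K v) ≤ U) n y = 0) :
    locTower K (v.adicCompletion K) F X U hU n y = 0 := by
  rw [← locTower_resLe K (v.adicCompletion K) F X inf_le_left
    (absGaloisRestrictTower_mem_inf_stabilizer K v F hU) n y, hy, map_zero]

end NumberField

end Literature.NumberTheory.GaloisRepresentations

end
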